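import Summits.QuantumFields.BalabanUV.T4Continuum.Support.VariationalVectorFederbushLine
import Summits.QuantumFields.BalabanUV.T4Continuum.Support.VariationalColourPoincareLocal

/-!
# T⁴ programme, spine node NE2 (U1a), lane P2 — LEAF V-P, CORE (i): THE POINCARÉ INEQUALITY FOR THE LINE-SUM AVERAGE OF `E`-VALUED 1-FORMS
# (the ROUGH form controls the `ℓ²` size modulo the transported (1.18) average), and the reduction «V-P ⟸ a GÅRDING inequality for the vector form»
# (`t4/skeletons/NE2-t4-ne2-p2.md` v0.15 §2.E row V-P; model level; one level, every torus; cell `pub-balaban`)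

NE2 formalisation swarm `b2b-balaban-t4-ne2-formalise-*`, leaf prover 01 GEN 5 (`prover-b2b-balaban-t4-ne2-formalise-leaf-01-g5-0`); journal INTENT CLAIMS.log
2026-08-20 12:28Z.  On top of leaf-02-g4's V-COL-P `VariationalColourPoincareLocal.nsqv_le_colour_poincare_of_blockOf` (p216332: the covariant block Poincaré
inequality for `E`-valued 0-FORMS under unitary site transports, SAME constants as the scalar leaf), the colour Federbush count
`VariationalColourFederbush.sum_sq_main_le` (p214930) and this lineage's `VariationalVectorFederbush.{lineT, line_telescope}` (p217357 ∕ p216586) — BY NAME.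

THE POINT.  The 1-form average of the road is the LINE-SUM (tent) average `QvL` ([Balaban1984PropagatorsI] (1.18)), not the site average `Qcv` of the 0-form
leaves; but for PRODUCT line transports `T(y,j,t,μ) = T′(n·y+j)∘Π^μ_t(n·y+j)` every line telescopes covariantly, so the tent average of the `μ`-component
differs from its transported SITE average by straight-line sums of the covariant differences `D_μW_μ`:
 * §1 **`QvL_lineT_eq_Qcv_add`**: `Q_{T′∘Π}W(z,μ) = Q_{T′}(W_μ)(z) + n^{−(d+1)}•Σ_j T′(b_j)(Σ_{t<n} Σ_{s<t} Π^μ_s(b_j)((D_μW_μ)(b_j + s e_μ)))` EXACTLY, and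
   **`sum_sq_Qcv_le`**: `Σ_z ‖Q_{T′}(W_μ)(z)‖² ≤ 2·Σ_z ‖Q_{T′∘Π}W(z,μ)‖² + 2·(n²∕n^d)·Σ_x‖(D_μW_μ)(x)‖²`;
 * §2 **`nsqV_le_line_poincare`** (lattice units): for a finite-dimensional Hilbert space `E`, UNITARY site transports `T′`, contractive bond transports `R′` and
   the IN-BLOCK defect `‖R′(x,μ)∘T′(x+e_μ)⋆∘T′(x) − 1‖ ≤ w` on bonds with both ends in one block, `2d·(n·w)² ≤ ½` (leaf-02-g4's ∕ leaf-03-g4's binder verbatim):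
   `Σ_{x,μ}‖W(x,μ)‖² ≤ 16·n^d·Σ_{z,μ}‖Q_{T′∘Π}W(z,μ)‖² + 20·n²·roughV R′ W`;
   in the road owner's letters **`qWV_le_line_poincare`**: `qWV n M W ≤ 16·nsqV M (QvL n M (lineT T′ R′) W) + 20·(n^{−d}·(n²·roughV n M R′ W))`
   — the `hPc` binder of `VariationalVectorForm.vector_pair_bracket_sqrt` FOR THE ROUGH FORM, `C_P = 20`, per-block small field only.
 * §3 **`qWV_le_of_garding`** — THE REDUCTION: any displayed GÅRDING inequality for the fixed vector form,
   (Går) `n^{−d}·(n²·roughV R′ W) ≤ κ·ScV n M R′ G W + κ′·nsqV M (Q W)`, gives `hPc` verbatim: `qWV W ≤ max(20κ, 16 + 20κ′)·(ScV W + nsqV (Q W))`.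
   SO LEAF V-P = (Går).  HONEST about (Går): for the pure curl form (`G = 0`) it is FALSE — a pure-gauge direction `W = D_{R′}λ′` whose 0-form has zero
   block means has `curl ≈ 0`, `Q W ≈ 0` (this lineage's `VariationalVectorExterior.QvL_cDv_flat`: `Q_1(Dλ′) = n⁻¹D(Q_1λ′)`) and `W ≠ 0`; (Går) is the job
   of the gauge functional `G` of decision (D2) ([B9] (3.26) «D R(U) D*»: the lattice Weitzenböck identity `LatticeWeitzenbock.weitzenbock` + the scalar
   Green's function) — UNOWNED since the road owner retired (CLAIMS.log l.11820), named here precisely, NOT proved here.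
WHAT IS NOT HERE: (Går); the level-`n·L` socket `hPf` (the same lemma at block side `n·L` once leaf-03-g4's V-COMP-L presents `Qk ∘ Q₁` as a `QvL` with composite
product transports); anything about minimisers.

HONEST FRAMING (T4-DAG p. 1).  Model level; transports DATA (no identification with Bałaban's `U(Γ)` — c5); [folklore] telescoping + Cauchy–Schwarz on top of
the colour P⁺ leaf; nothing printed is a hypothesis; no `def`, no `def … : Prop`, no `sorry`; axioms standard.  V-P NOT proved (only its averaging half); NE2 NOT
proved; spine PROVED 0∕9 unchanged; rung (B)+1 finite T⁴ — NOT infinite volume, NOT mass gap, NOT Clay.  HONEST DEPENDENCY (cell, verbatim): continuum YM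
on T⁴ ⇐ BetaPertH ∧ nine spine estimates (0/9 proved); BetaPertH ⇐ (D1) ∧ (D4) ∧ CAP+tail; G-an2-4 gates asym, D1 and NE2/3/4.
-/

noncomputable section

namespace Summit.QuantumFields.BalabanUV.T4Continuum.VariationalVectorPoincare

open Finset
open Literature.MathematicalPhysics.QuantumFieldTheory.Balaban1983to89
open Literature.MathematicalPhysics.QuantumFieldTheory.Balaban1983to89.B5Prop11Plancherel (Tor fine unitVec)
open Literature.MathematicalPhysics.QuantumFieldTheory.Balaban1983to89.B5Block118 (tstep bpt)
open Literature.MathematicalPhysics.QuantumFieldTheory.Balaban1983to89.B5Blocks16 (blockOf)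
open Summit.QuantumFields.BalabanUV.T4Continuum.VariationalColourFederbush (cDv dirUv Qcv piTv norm_piTv_le_one sum_sq_main_le)
open Summit.QuantumFields.BalabanUV.T4Continuum.VariationalColourUpperBound (nsqv nsqv_nonneg)
open Summit.QuantumFields.BalabanUV.T4Continuum.VariationalColourPoincareLocal (nsqv_le_colour_poincare_of_blockOf)
open Summit.QuantumFields.BalabanUV.T4Continuum.VectorBlockTrialForm (nsqV nsqV_nonneg QvL roughV roughV_nonneg)
open Summit.QuantumFields.BalabanUV.T4Continuum.VariationalVectorForm (cdV ScV qWV)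
open Summit.QuantumFields.BalabanUV.T4Continuum.VariationalVectorFederbush (lineT line_telescope)

variable {d : ℕ} {E : Type*} [NormedAddCommGroup E] [InnerProductSpace ℂ E] [CompleteSpace E]
variable (n : ℕ) [NeZero n] (M : Fin d → ℕ) [hM : ∀ μ, NeZero (M μ)]
variable {T' : Tor (fine n M) → (E →L[ℂ] E)} {R' : Tor (fine n M) → Fin d → (E →L[ℂ] E)}

/-! ## §1 Tent average versus site average of one component -/

omit [CompleteSpace E] hM in
/-- **TENT = SITE + STRAIGHT-LINE SUMS, EXACTLY**: for product line transports,
`Q_{T′∘Π}W(z,μ) = Q_{T′}(W_μ)(z) + n^{−(d+1)} • Σ_j T′(b_j)(Σ_{t<n} Σ_{s<t} Π^μ_s(b_j)((D_μW_μ)(b_j + s e_μ)))`. [folklore] -/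
theorem QvL_lineT_eq_Qcv_add (W : Tor (fine n M) → Fin d → E) (z : Tor M) (μ : Fin d) :
    QvL n M (lineT n M T' R') W z μ
      = Qcv n M T' (fun x => W x μ) z
        + (((n : ℂ) ^ (d + 1))⁻¹ : ℂ) • ∑ j : Fin d → Fin n, T' (bpt n M z j)
            (∑ t : Fin n, ∑ s ∈ range (t : ℕ), piTv n M R' (bpt n M z j) μ s (cdV (fine n M) R' W (bpt n M z j + tstep (fine n M) μ s) μ μ)) := by
  have hn : (n : ℂ) ≠ 0 := by exact_mod_cast NeZero.ne n
  -- each line: `T′(b)(Π_t W(b + t e)) = T′(b)(W b) + T′(b)(Σ_{s<t} Π_s D_μW_μ)`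
  have hline : ∀ (j : Fin d → Fin n) (t : Fin n),
      lineT n M T' R' z j t μ (W (bpt n M z j + tstep (fine n M) μ t) μ)
        = T' (bpt n M z j) (W (bpt n M z j) μ)
          + T' (bpt n M z j) (∑ s ∈ range (t : ℕ), piTv n M R' (bpt n M z j) μ s (cdV (fine n M) R' W (bpt n M z j + tstep (fine n M) μ s) μ μ)) := by
    intro j t
    rw [← map_add, ← line_telescope n M R' W (bpt n M z j) μ μ t, add_sub_cancel]
    rfl
  -- the site average as a double sum with the scalar `n^{−(d+1)}`
  have hsite : Qcv n M T' (fun x => W x μ) z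
      = (((n : ℂ) ^ (d + 1))⁻¹ : ℂ) • ∑ j : Fin d → Fin n, ∑ _t : Fin n, T' (bpt n M z j) (W (bpt n M z j) μ) := by
    unfold Qcv
    simp only [sum_const, Finset.card_univ, Fintype.card_fin, ← Nat.cast_smul_eq_nsmul ℂ, ← Finset.smul_sum, smul_smul]
    congr 1
    rw [pow_succ, mul_inv, mul_assoc, inv_mul_cancel₀ hn, mul_one]
  rw [hsite, ← smul_add, ← sum_add_distrib]
  unfold QvL
  congr 1
  refine sum_congr rfl fun j _ => ?_
  rw [map_sum, ← sum_add_distrib]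
  exact sum_congr rfl fun t _ => hline j t

omit [CompleteSpace E] hM in
/-- the straight-line sums are small in the mean square: `‖Q_{T′∘Π}W(z,μ) − Q_{T′}(W_μ)(z)‖ ≤ n^{−d}·Σ_j Σ_{s<n} ‖(D_μW_μ)(b_j + s e_μ)‖` for contractive `T′`, `R′`.
[folklore] -/
theorem norm_QvL_sub_Qcv_le (hT' : ∀ x, ‖T' x‖ ≤ 1) (hR' : ∀ x μ, ‖R' x μ‖ ≤ 1) (W : Tor (fine n M) → Fin d → E) (z : Tor M) (μ : Fin d) :
    ‖QvL n M (lineT n M T' R') W z μ - Qcv n M T' (fun x => W x μ) z‖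
      ≤ ((n : ℝ) ^ d)⁻¹ * ∑ j : Fin d → Fin n, ∑ s ∈ range n, ‖cDv (fine n M) R' (fun x => W x μ) (bpt n M z j + tstep (fine n M) μ s) μ‖ := by
  have hn : (0 : ℝ) < n := by exact_mod_cast Nat.pos_of_ne_zero (NeZero.ne n)
  rw [QvL_lineT_eq_Qcv_add n M W z μ, add_sub_cancel_left, norm_smul, norm_inv, norm_pow, Complex.norm_natCast]
  -- per line point: contractions, then enlarge `range t ⊆ range n`
  have hj : ∀ j : Fin d → Fin n,
      ‖T' (bpt n M z j) (∑ t : Fin n, ∑ s ∈ range (t : ℕ), piTv n M R' (bpt n M z j) μ s (cdV (fine n M) R' W (bpt n M z j + tstep (fine n M) μ s) μ μ))‖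
        ≤ (n : ℝ) * ∑ s ∈ range n, ‖cDv (fine n M) R' (fun x => W x μ) (bpt n M z j + tstep (fine n M) μ s) μ‖ := by
    intro j
    have hcd : ∀ s : ℕ, cdV (fine n M) R' W (bpt n M z j + tstep (fine n M) μ s) μ μ
        = cDv (fine n M) R' (fun x => W x μ) (bpt n M z j + tstep (fine n M) μ s) μ := fun s => rfl
    calc _ ≤ ‖T' (bpt n M z j)‖ * ‖∑ t : Fin n, ∑ s ∈ range (t : ℕ), piTv n M R' (bpt n M z j) μ s
            (cdV (fine n M) R' W (bpt n M z j + tstep (fine n M) μ s) μ μ)‖ := ContinuousLinearMap.le_opNorm _ _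
      _ ≤ 1 * ∑ _t : Fin n, ∑ s ∈ range n, ‖cDv (fine n M) R' (fun x => W x μ) (bpt n M z j + tstep (fine n M) μ s) μ‖ := by
          refine mul_le_mul (hT' _) ((norm_sum_le _ _).trans (sum_le_sum fun t _ => (norm_sum_le _ _).trans ?_)) (norm_nonneg _) zero_le_one
          refine (sum_le_sum fun s _ => ?_).trans
            (sum_le_sum_of_subset_of_nonneg (fun x hx => mem_range.2 ((mem_range.1 hx).trans_le t.is_lt.le)) fun _ _ _ => norm_nonneg _)
          rw [hcd]
          calc _ ≤ ‖piTv n M R' (bpt n M z j) μ s‖ * ‖cDv (fine n M) R' (fun x => W x μ) (bpt n M z j + tstep (fine n M) μ s) μ‖ :=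
                ContinuousLinearMap.le_opNorm _ _
            _ ≤ 1 * _ := mul_le_mul_of_nonneg_right (norm_piTv_le_one n M hR' _ _ _) (norm_nonneg _)
            _ = _ := one_mul _
      _ = _ := by rw [one_mul, sum_const, Finset.card_univ, Fintype.card_fin, nsmul_eq_mul]
  have hpow : ((n : ℝ) ^ (d + 1))⁻¹ * ((n : ℝ) * ∑ j : Fin d → Fin n, ∑ s ∈ range n,
      ‖cDv (fine n M) R' (fun x => W x μ) (bpt n M z j + tstep (fine n M) μ s) μ‖)
      = ((n : ℝ) ^ d)⁻¹ * ∑ j : Fin d → Fin n, ∑ s ∈ range n, ‖cDv (fine n M) R' (fun x => W x μ) (bpt n M z j + tstep (fine n M) μ s) μ‖ := by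
    rw [pow_succ]; field_simp
  rw [← hpow]
  refine mul_le_mul_of_nonneg_left ?_ (by positivity)
  rw [Finset.mul_sum]
  exact (norm_sum_le _ _).trans (sum_le_sum fun j _ => hj j)

omit [CompleteSpace E] in
/-- **SITE AVERAGE CONTROLLED BY TENT AVERAGE + `D_μW_μ`**: `Σ_z ‖Q_{T′}(W_μ)(z)‖² ≤ 2·Σ_z ‖Q_{T′∘Π}W(z,μ)‖² + 2·(n²∕n^d)·Σ_x ‖(D_μW_μ)(x)‖²`. [folklore] -/
theorem sum_sq_Qcv_le (hT' : ∀ x, ‖T' x‖ ≤ 1) (hR' : ∀ x μ, ‖R' x μ‖ ≤ 1) (W : Tor (fine n M) → Fin d → E) (μ : Fin d) :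
    ∑ z, ‖Qcv n M T' (fun x => W x μ) z‖ ^ 2
      ≤ 2 * ∑ z, ‖QvL n M (lineT n M T' R') W z μ‖ ^ 2 + 2 * ((n : ℝ) ^ 2 / (n : ℝ) ^ d * dirUv (fine n M) R' (fun x => W x μ) μ) := by
  have hn : (0 : ℝ) < n := by exact_mod_cast Nat.pos_of_ne_zero (NeZero.ne n)
  have hnd : (0 : ℝ) < (n : ℝ) ^ d := by positivity
  -- the mean square of the deviation
  have hdev : ∑ z, ‖QvL n M (lineT n M T' R') W z μ - Qcv n M T' (fun x => W x μ) z‖ ^ 2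
      ≤ (n : ℝ) ^ 2 / (n : ℝ) ^ d * dirUv (fine n M) R' (fun x => W x μ) μ := by
    have hmain := sum_sq_main_le n M R' (fun x => W x μ) μ
    calc _ ≤ ∑ z : Tor M, (((n : ℝ) ^ d)⁻¹ * ∑ j : Fin d → Fin n, ∑ s ∈ range n,
            ‖cDv (fine n M) R' (fun x => W x μ) (bpt n M z j + tstep (fine n M) μ s) μ‖) ^ 2 :=
          sum_le_sum fun z _ => pow_le_pow_left₀ (norm_nonneg _) (norm_QvL_sub_Qcv_le n M hT' hR' W z μ) 2
      _ = (((n : ℝ) ^ d)⁻¹) ^ 2 * ∑ z : Tor M, (∑ j : Fin d → Fin n, ∑ s ∈ range n,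
            ‖cDv (fine n M) R' (fun x => W x μ) (bpt n M z j + tstep (fine n M) μ s) μ‖) ^ 2 := by
          rw [mul_sum]; exact sum_congr rfl fun z _ => by ring
      _ ≤ (((n : ℝ) ^ d)⁻¹) ^ 2 * ((n : ℝ) ^ d * n * (n * dirUv (fine n M) R' (fun x => W x μ) μ)) :=
          mul_le_mul_of_nonneg_left hmain (sq_nonneg _)
      _ = _ := by field_simp
  calc ∑ z, ‖Qcv n M T' (fun x => W x μ) z‖ ^ 2
      ≤ ∑ z, (2 * ‖QvL n M (lineT n M T' R') W z μ‖ ^ 2 + 2 * ‖QvL n M (lineT n M T' R') W z μ - Qcv n M T' (fun x => W x μ) z‖ ^ 2) := by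
        refine sum_le_sum fun z _ => ?_
        have h := norm_sub_le (QvL n M (lineT n M T' R') W z μ) (QvL n M (lineT n M T' R') W z μ - Qcv n M T' (fun x => W x μ) z)
        rw [sub_sub_cancel] at h
        nlinarith [norm_nonneg (Qcv n M T' (fun x => W x μ) z), norm_nonneg (QvL n M (lineT n M T' R') W z μ),
          norm_nonneg (QvL n M (lineT n M T' R') W z μ - Qcv n M T' (fun x => W x μ) z),
          sq_nonneg (‖QvL n M (lineT n M T' R') W z μ‖ - ‖QvL n M (lineT n M T' R') W z μ - Qcv n M T' (fun x => W x μ) z‖)]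
    _ = 2 * ∑ z, ‖QvL n M (lineT n M T' R') W z μ‖ ^ 2 + 2 * ∑ z, ‖QvL n M (lineT n M T' R') W z μ - Qcv n M T' (fun x => W x μ) z‖ ^ 2 := by
        rw [sum_add_distrib, mul_sum, mul_sum]
    _ ≤ _ := by linarith [hdev]

/-! ## §2 The Poincaré inequality for the line-sum average of 1-forms (rough form) -/

omit [InnerProductSpace ℂ E] [CompleteSpace E] in
/-- the `ℓ²` size of a 1-form is the sum of its components' sizes. [folklore] -/
theorem nsqV_eq_sum_nsqv (W : Tor (fine n M) → Fin d → E) : nsqV (fine n M) W = ∑ μ, nsqv (fun x => W x μ) := by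
  unfold nsqV nsqv
  exact Finset.sum_comm

omit [CompleteSpace E] in
/-- the rough form is the sum over components of their covariant Dirichlet sums. [folklore] -/
theorem roughV_eq_sum_dirUv (R : Tor (fine n M) → Fin d → (E →L[ℂ] E)) (W : Tor (fine n M) → Fin d → E) :
    roughV n M R W = ∑ μ, ∑ ν, dirUv (fine n M) R (fun x => W x μ) ν := by
  unfold roughV dirUv cDv
  exact Finset.sum_comm

/-- **LEAF V-P, CORE (i) — THE POINCARÉ INEQUALITY FOR THE LINE-SUM AVERAGE (lattice units)**: finite-dimensional Hilbert `E`; UNITARY site transports `T′`,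
contractive bond transports `R′`, the IN-BLOCK defect `‖R′(x,μ)∘T′(x+e_μ)⋆∘T′(x) − 1‖ ≤ w` on bonds with both ends in one block and `2d·(n·w)² ≤ ½`:
`Σ_{x,μ}‖W(x,μ)‖² ≤ 16·n^d·Σ_{z,μ}‖Q_{T′∘Π}W(z,μ)‖² + 20·n²·roughV R′ W`. [folklore] -/
theorem nsqV_le_line_poincare [FiniteDimensional ℂ E] (hT' : ∀ x, T' x ∈ unitary (E →L[ℂ] E)) (hR' : ∀ x μ, ‖R' x μ‖ ≤ 1) {w : ℝ}
    (hw : ∀ (x : Tor (fine n M)) (μ : Fin d), blockOf n M (x + unitVec (fine n M) μ) = blockOf n M x →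
      ‖R' x μ * star (T' (x + unitVec (fine n M) μ)) * T' x - 1‖ ≤ w)
    (hsmall : 2 * (d : ℝ) * ((n : ℝ) * w) ^ 2 ≤ 1 / 2) (W : Tor (fine n M) → Fin d → E) :
    nsqV (fine n M) W
      ≤ 16 * (n : ℝ) ^ d * nsqV M (QvL n M (lineT n M T' R') W) + 20 * (n : ℝ) ^ 2 * roughV n M R' W := by
  have hn : (0 : ℝ) < n := by exact_mod_cast Nat.pos_of_ne_zero (NeZero.ne n)
  have hnd : (0 : ℝ) < (n : ℝ) ^ d := by positivity
  have hT1 : ∀ x, ‖T' x‖ ≤ 1 := fun x => VariationalColourFederbush.norm_le_one_of_mem_unitary (hT' x)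
  -- per component
  have hμ : ∀ μ : Fin d, nsqv (fun x => W x μ)
      ≤ 16 * (n : ℝ) ^ d * ∑ z, ‖QvL n M (lineT n M T' R') W z μ‖ ^ 2 + 20 * (n : ℝ) ^ 2 * ∑ ν, dirUv (fine n M) R' (fun x => W x μ) ν := by
    intro μ
    have hP := nsqv_le_colour_poincare_of_blockOf n M (R := R') hT' hw hsmall (fun x => W x μ)
    have hQ := sum_sq_Qcv_le n M hT1 hR' W μ
    have hdir0 : ∀ ν, 0 ≤ dirUv (fine n M) R' (fun x => W x μ) ν := fun ν => VariationalColourFederbush.dirUv_nonneg _ _ _ _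
    have hμμ : dirUv (fine n M) R' (fun x => W x μ) μ ≤ ∑ ν, dirUv (fine n M) R' (fun x => W x μ) ν :=
      Finset.single_le_sum (fun ν _ => hdir0 ν) (Finset.mem_univ μ)
    have hsum0 : 0 ≤ ∑ ν, dirUv (fine n M) R' (fun x => W x μ) ν := sum_nonneg fun ν _ => hdir0 ν
    have e : (n : ℝ) ^ d * ((n : ℝ) ^ 2 / (n : ℝ) ^ d * dirUv (fine n M) R' (fun x => W x μ) μ)
        = (n : ℝ) ^ 2 * dirUv (fine n M) R' (fun x => W x μ) μ := by field_simp
    calc nsqv (fun x => W x μ)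
        ≤ 8 * (n : ℝ) ^ d * ∑ z, ‖Qcv n M T' (fun x => W x μ) z‖ ^ 2 + 4 * (n : ℝ) ^ 2 * ∑ ν, dirUv (fine n M) R' (fun x => W x μ) ν := hP
      _ ≤ 8 * (n : ℝ) ^ d * (2 * ∑ z, ‖QvL n M (lineT n M T' R') W z μ‖ ^ 2 + 2 * ((n : ℝ) ^ 2 / (n : ℝ) ^ d * dirUv (fine n M) R' (fun x => W x μ) μ))
          + 4 * (n : ℝ) ^ 2 * ∑ ν, dirUv (fine n M) R' (fun x => W x μ) ν := by gcongr
      _ = 16 * (n : ℝ) ^ d * ∑ z, ‖QvL n M (lineT n M T' R') W z μ‖ ^ 2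
          + (16 * ((n : ℝ) ^ d * ((n : ℝ) ^ 2 / (n : ℝ) ^ d * dirUv (fine n M) R' (fun x => W x μ) μ))
            + 4 * (n : ℝ) ^ 2 * ∑ ν, dirUv (fine n M) R' (fun x => W x μ) ν) := by ring
      _ ≤ _ := by rw [e]; nlinarith [hμμ, hsum0, sq_nonneg (n : ℝ)]
  -- sum over components
  have hQsum : ∑ μ : Fin d, ∑ z, ‖QvL n M (lineT n M T' R') W z μ‖ ^ 2 = nsqV M (QvL n M (lineT n M T' R') W) := by
    unfold nsqV; exact Finset.sum_comm
  rw [nsqV_eq_sum_nsqv n M W, roughV_eq_sum_dirUv n M R' W, ← hQsum, mul_sum, mul_sum, ← sum_add_distrib]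
  exact sum_le_sum fun μ _ => hμ μ

/-- **THE SAME IN THE ROAD OWNER'S LETTERS** (physical units): `qWV n M W ≤ 16·nsqV M (QvL n M (lineT T′ R′) W) + 20·(n^{−d}·(n²·roughV n M R′ W))` —
the `hPc` binder of `VariationalVectorForm.vector_pair_bracket_sqrt` FOR THE ROUGH FORM (`C_P = 20`; `Qk := QvL n M (lineT T′ R′)`). [folklore] -/
theorem qWV_le_line_poincare [FiniteDimensional ℂ E] (hT' : ∀ x, T' x ∈ unitary (E →L[ℂ] E)) (hR' : ∀ x μ, ‖R' x μ‖ ≤ 1) {w : ℝ}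
    (hw : ∀ (x : Tor (fine n M)) (μ : Fin d), blockOf n M (x + unitVec (fine n M) μ) = blockOf n M x →
      ‖R' x μ * star (T' (x + unitVec (fine n M) μ)) * T' x - 1‖ ≤ w)
    (hsmall : 2 * (d : ℝ) * ((n : ℝ) * w) ^ 2 ≤ 1 / 2) (W : Tor (fine n M) → Fin d → E) :
    qWV n M W ≤ 16 * nsqV M (QvL n M (lineT n M T' R') W) + 20 * (((n : ℝ) ^ d)⁻¹ * ((n : ℝ) ^ 2 * roughV n M R' W)) := by
  have hnd : (0 : ℝ) < (n : ℝ) ^ d := by have := Nat.pos_of_ne_zero (NeZero.ne n); positivity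
  have h := nsqV_le_line_poincare n M hT' hR' hw hsmall W
  unfold qWV
  rw [inv_mul_le_iff₀ hnd]
  calc nsqV (fine n M) W ≤ _ := h
    _ = _ := by field_simp

/-! ## §3 The reduction: V-P ⟸ a Gårding inequality for the vector form -/

/-- **V-P ⟸ (Går)**: if the fixed vector form `ScV n M R′ G` of decision (D2) satisfies a Gårding inequality against the rough form modulo the average,
`n^{−d}·(n²·roughV R′ W) ≤ κ·ScV W + κ′·nsqV (Q_{T′∘Π} W)` (DISPLAYED — the gauge functional's job; false for `G = 0` on pure-gauge directions), then the
`hPc` binder of `vector_pair_bracket_sqrt` holds with `C_P = max(20κ, 16 + 20κ′)`. [folklore] -/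
theorem qWV_le_of_garding [FiniteDimensional ℂ E] (hT' : ∀ x, T' x ∈ unitary (E →L[ℂ] E)) (hR' : ∀ x μ, ‖R' x μ‖ ≤ 1) {w : ℝ}
    (hw : ∀ (x : Tor (fine n M)) (μ : Fin d), blockOf n M (x + unitVec (fine n M) μ) = blockOf n M x →
      ‖R' x μ * star (T' (x + unitVec (fine n M) μ)) * T' x - 1‖ ≤ w)
    (hsmall : 2 * (d : ℝ) * ((n : ℝ) * w) ^ 2 ≤ 1 / 2) {G : (Tor (fine n M) → Fin d → E) → ℝ} (hG0 : ∀ W, 0 ≤ G W) {κ κ' : ℝ}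
    (hGar : ∀ W, ((n : ℝ) ^ d)⁻¹ * ((n : ℝ) ^ 2 * roughV n M R' W) ≤ κ * ScV n M R' G W + κ' * nsqV M (QvL n M (lineT n M T' R') W))
    (W : Tor (fine n M) → Fin d → E) :
    qWV n M W ≤ max (20 * κ) (16 + 20 * κ') * (ScV n M R' G W + nsqV M (QvL n M (lineT n M T' R') W)) := by
  have h := qWV_le_line_poincare n M hT' hR' hw hsmall W
  have hS0 : 0 ≤ ScV n M R' G W := VariationalVectorForm.ScV_nonneg n M R' hG0 W
  have hN0 : 0 ≤ nsqV M (QvL n M (lineT n M T' R') W) := nsqV_nonneg M _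
  have h1 : 20 * κ ≤ max (20 * κ) (16 + 20 * κ') := le_max_left _ _
  have h2 : 16 + 20 * κ' ≤ max (20 * κ) (16 + 20 * κ') := le_max_right _ _
  calc qWV n M W ≤ 16 * nsqV M (QvL n M (lineT n M T' R') W) + 20 * (((n : ℝ) ^ d)⁻¹ * ((n : ℝ) ^ 2 * roughV n M R' W)) := h
    _ ≤ 16 * nsqV M (QvL n M (lineT n M T' R') W) + 20 * (κ * ScV n M R' G W + κ' * nsqV M (QvL n M (lineT n M T' R') W)) := by
        linarith [hGar W]
    _ = (20 * κ) * ScV n M R' G W + (16 + 20 * κ') * nsqV M (QvL n M (lineT n M T' R') W) := by ring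
    _ ≤ max (20 * κ) (16 + 20 * κ') * ScV n M R' G W + max (20 * κ) (16 + 20 * κ') * nsqV M (QvL n M (lineT n M T' R') W) :=
        add_le_add (mul_le_mul_of_nonneg_right h1 hS0) (mul_le_mul_of_nonneg_right h2 hN0)
    _ = _ := by ring

end Summit.QuantumFields.BalabanUV.T4Continuum.VariationalVectorPoincare

end
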